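import Mathlib.RingTheory.Radical.NatInt
import Mathlib.Data.Nat.Factorization.Induction
import Mathlib.Analysis.SpecialFunctions.Pow.Real
import HarnessLib
import HarnessLib.Audit

/-!
# ABC harvest — door C13 «STACKY NORTHCOTT» (Nasserden–Xiao): the Props and the `φ_m` toolkit

`Summits/ABC/Harvest/StackyNorthcott.lean` — cell `abc-harv`, seat abc-harv-pr-2 (KEY PR-STACKY, g6-D40 (2c)),
namespace `Summit.ABC.Harvest`; REDUCTION-CENSUS row C13 / lit-1 RC-CAND abc-harv-lit-1-4. STATEMENT file
(two PROOF-FREE `@[conjecture]` Props) plus the elementary, sorry-free toolkit for the arithmetic function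
`φ_m` that both printed arrows consume. The arrows themselves — abc ⟹ `StackyNorthcott m` (every `m ≥ 1`)
and `StackyNorthcott m` ⟹ `PolyABC M` for every `M > (m-1)/(m-3)` (`m ≥ 4`), hence
`ABC ↔ ∀ m ≥ 4, StackyNorthcott m` — are PROVED (no named fact, no hypothesis) in the proof-only companion
`Summits/ABC/Harvest/GlueStacky.lean`.

## Source (primary, HELD: B. Nasserden, S. Y. Xiao, *Heights and quantitative arithmetic on stacky curves*,
Canad. J. Math. 77 (2025) 481–534 = arXiv:2108.04411; corpus `paper:arxiv-2108.04411`, pages as chunks `p00nn`)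

* §2.1, p. 6 [p0006]: «For each `m_i` define `φ_{m_i}(n)` is defined to be the smallest positive integer such
  that `n φ_{m_i}(n)` is a perfect `m_i`-th power.» and the *Stacky Curve Height Machine*
  `H_𝒟(x,y) = max{|x|,|y|}^{deg 𝒟} · ∏ φ_{m_i}(ℓ_i(x,y)^{c_i})^{1/m_i}` «whenever `x, y` are coprime integers»,
  `ℓ_i(x,y) = α_i y − β_i x` the linear form of the stacky point `a_i = [α_i : β_i]`; (2.2)
  `H_{−K_𝔛}(x,y) = max{|x|,|y|}^{χ(𝔛)} ∏ φ_{m_i}(ℓ_i(x,y))^{1/m_i}`, `χ(𝔛) = 2 − Σ (1 − 1/m_i)`.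
* §2.2, p. 9 [p0009]: (2.5) «For a real number `δ` … define the height
  `ℋ^δ_{(𝐚,𝐦)}(x,y) = ∏ φ_{m_i}(ℓ_i(x,y))^{1/m_i} · max{|x|,|y|}^δ`. We then see that `ℋ_{(𝐚,𝐦)} = ℋ^{δ(𝐦)}`»;
  Conjecture 2.6 «`γ(𝔛) = min{δ(𝐦), 0}`»; **Theorem 2.7** «We have `γ(𝔛) = 0` if `χ(𝔛) = δ(𝐦) ≥ 0` …»;
  **Theorem 2.8** «Suppose that the abc-conjecture holds. Then for any `δ > δ(𝐦)` the function
  `ℋ^δ_{(𝐚,𝐦)}(x,y)` on `𝔛(ℙ¹ : (𝐚,𝐦))` has Northcott's property.»; p. 9 also: «Using that `PGL₂` acts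
  3-transitively on `ℙ¹`, we reduce to the case `{a₁, a₂, a₃} = {0, −1, ∞}`».
* §1, p. 4 [p0004 L18–30]: **Theorem 1.4** «Let `𝔛` be a proper smooth stacky curve defined over `ℚ` that has
  coarse space `ℙ¹` or is isomorphic to a smooth projective curve. Further suppose that `𝔛` has negative Euler
  characteristic. Then the following statements are equivalent: • The abc-conjecture holds; and • For all `𝔛`
  satisfying the hypotheses of the theorem and for all `δ > 0` the function `ℋ_{−K_𝔛} · H^δ` has Northcott's
  property, where `H([x,y]) = max{|x|,|y|}` is the usual height function on `ℙ¹(ℚ)`.» followed by the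
  SINGLE-CURVE REMARK «The proof of Theorem 1.4 shows that if there is some `m ≥ 4` such that item (2) in
  Theorem 1.4 holds for `𝔛_m = 𝔛(ℙ¹ : ((0,1,∞) : (m,m,m))` then a weak variant of the abc-conjecture can be
  derived. Specifically, there exists a positive number `c_m ≥ 1` such that for any co-prime `a,b,c ∈ ℤ` with
  `a + b = c` and `ε > 0` that `max{|a|,|b|,|c|} ≪_{ε,m} rad(abc)^{c_m+ε}`.» [p0005 L1] «In particular, any
  progress on the stacky Vojta conjecture for curves would lead to substantial progress on the abc-conjecture.»
* §6.2, p. 25 [p0025 L100–140], the 12-line proof: (6.?) `H_{−K_{𝔛_m}}(𝐱) = φ_m(x)^{1/m} φ_m(y)^{1/m}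
  φ_m(x+y)^{1/m} max{|x|,|y|}^{3/m−1}`; «Trivially, we see that `φ_m(u) ≤ rad(u)^{m−1}` for all `u ∈ ℤ`»;
  «Since `x, y, x+y` are pairwise co-prime we have `rad(x)rad(y)rad(x+y) = rad(xy(x+y))`»; conclusion
  `rad(xy(x+y)) ≫_κ max{|x|,|y|}^{(m−3)/(m−1) ∓ κm/(2(m−1))}` (the display prints `+κ/2` where `−κ` is meant —
  immaterial, `κ → 0`; the kernel proof in `GlueStacky.lean` carries the honest sign), whence the single-curve
  exponent **`c_m = (m−1)/(m−3)`** (lit-1's reading, confirmed by the kernel: `polyABC_of_stackyNorthcott`):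
  `m = 4 ↦ POLY-ABC(3+ε)`, `5 ↦ 2+ε`, `6 ↦ 5/3+ε`, `7 ↦ 3/2+ε`, `m → ∞ ↦ 1+ε`.
* Cross-check of the typed shape (secondary, HELD): Ellenberg–Satriano–Zureick-Brown, Forum Math. Sigma 11
  (2023) e14 = arXiv:2106.11340, p. 32 [p0032 L28–36]: «if `𝒳` is a `(4,4,4)`-rooted `ℙ¹` with the
  `(1/4)`th-points at `0, −1, ∞`, then we have `edd(a:b) = log Φ₄(a)^{1/4} Φ₄(b)^{1/4} Φ₄(a+b)^{1/4}
  max(|a|,|b|)^{−1/4}` and the claim is then that the inequality `Φ₄(a) Φ₄(b) Φ₄(a+b) < max(|a|,|b|)^{1−δ}` holds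
  for only finitely many pairs of coprime integers `a, b`.» — for `m = 4` this is `StackyNorthcott 4` below
  (`δ ↔ 4κ`); and [L44] «One may hope that individual cases of Conjecture 35, like those described above, might
  not be as far out of reach as abc and its generalizations.» (authors' hope; no mechanism in print).

## Reading of the Lean clauses against the source

* `ℙ¹(ℚ) ∋ [x : y]` ↔ pairs of coprime integers `(x, y)` (`IsCoprime x y` in `ℤ`; `(0,0)` is excluded
  automatically); every point is counted twice (`±(x,y)`) — immaterial for finiteness of sub-level sets.
* The three stacky points of `𝔛_m` are taken at `0, ∞, −1` (NX p. 9 reduction; ESZB p. 32), so the three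
  linear forms are `x`, `y`, `x + y` up to sign and the height is (2.5) with `n = 3`, `m_i = m`:
  `stackyHeight m δ x y = (φ_m|x| · φ_m|y| · φ_m|x+y|)^{1/m} · max(|x|,|y|)^δ` (`|·| = Int.natAbs`, the
  `m`-th root and `^δ` are `Real.rpow`). AT the three stacky points one form vanishes; the printed `φ_m(0)` is
  undefined, ours is the junk value `φ_m(0) = 1` (`0 · 1 = 0^m`): three (six signed) points, irrelevant to the
  Northcott property. `χ(𝔛_m) = 2 − 3(1 − 1/m) = 3/m − 1`, so `H_{−K_{𝔛_m}} · H^κ = ℋ^{3/m − 1 + κ}`.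
* «has Northcott's property» := every sub-level set `{ℋ ≤ B}` is finite (`Set.Finite`), `B` ranging over `ℝ`.
* `stackyPhi m n := sInf {d | 0 < d ∧ ∃ k, n·d = k^m}` is the printed «smallest positive integer such that
  `n φ_m(n)` is a perfect `m`-th power» verbatim; `sInf ∅ = 0` occurs only for `m = 0`, `n ≠ 1` (never used:
  every statement below has `m ≥ 1`, where `n^{m−1}` is a witness).

## Honesty (D-0138 / D-0139 / D-0140)

abc is not proved by any of this. For ONE `m ≥ 4`, `StackyNorthcott m` is SANDWICHED: abc ⟹ it
(`stackyNorthcott_of_abc`) ⟹ «NOT abc — POLY-ABC(c_m + ε)», `c_m = (m−1)/(m−3)` (`polyABC_of_stackyNorthcott`),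
and it is not known to be equivalent to either end; POLY-ABC(M) is NOT abc and is not known to give A-PS; the
whole ladder `∀ m ≥ 4` is a RESTATEMENT of abc (`abc_iff_forall_stackyNorthcott`), not a path.
Unconditionally nothing is proved for any `𝔛_m` beyond the trivial range of positive total exponent
`3/m − 1 + κ > 0` (`stackyNorthcottWith_of_exponent_pos`, NX Thm 2.7); NX's own unconditional result goes the
other way («Northfail», Thm 1.3: `H_{−K_𝔛}` itself is NOT Northcott when `χ(𝔛) ≤ 0` — the `κ` of
`StackyNorthcott` cannot be dropped, cf. `Literature.Barriers.ABC.EpsilonCannotBeDropped`).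
EFFECTIVE: no — a Northcott hypothesis is a bare finiteness statement; the poly-abc constant produced by the glue
is `2 · c₀^{−m/(m−3−κm)}` with `c₀ = min ℋ` over the (ineffective) exceptional set. Typed ≠ proved; computed ≠
proved; a primary is a source, not an endorsement; quoting ≠ agreeing.
-/

noncomputable section

open UniqueFactorizationMonoid

namespace Summit.ABC.Harvest

/-! ## §1 The objects: `φ_m`, the height `ℋ^δ` of `𝔛_m`, the Northcott Props -/

/-- **`φ_m(n)`** (Nasserden–Xiao §2.1, p. 6, after Ellenberg–Satriano–Zureick-Brown): «the smallest positive
integer such that `n φ_m(n)` is a perfect `m`-th power», as the infimum in `ℕ` of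
`{d | 0 < d ∧ ∃ k, n · d = k^m}`. For `m ≥ 1` the set is nonempty (`StackyPhi.spec`); explicitly
`φ_m(∏ p^{e_p}) = ∏ p^{(−e_p) mod m}`, `φ_m(0) = φ_m(1) = 1`. Junk: `sInf ∅ = 0` when `m = 0`, `n ≠ 1`
(documented, never used). [cite: NasserdenXiao2024, §2.1 p. 6] -/
def stackyPhi (m n : ℕ) : ℕ :=
  sInf {d : ℕ | 0 < d ∧ ∃ k : ℕ, n * d = k ^ m}

/-- **The height `ℋ^δ_{(𝐚,𝐦)}` of the stacky curve `𝔛_m = 𝔛(ℙ¹ : (0, ∞, −1), (m, m, m))` at the point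
`[x : y] ∈ ℙ¹(ℚ)`** (Nasserden–Xiao (2.5), p. 9, with `n = 3`, `m_i = m`, linear forms `x, y, x + y`):
`(φ_m|x| · φ_m|y| · φ_m|x + y|)^{1/m} · max(|x|, |y|)^δ`, `|·| = Int.natAbs`, real `m`-th root and real power
`δ`. At `δ = χ(𝔛_m) = 3/m − 1` this is the E-S-ZB anticanonical height `H_{−K_{𝔛_m}}` of §6.2 (p. 25);
`H_{−K_{𝔛_m}} · H^κ = ℋ^{3/m − 1 + κ}` with `H([x:y]) = max{|x|,|y|}`. Meaningful on coprime pairs; at the three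
stacky points (a form vanishes) the value uses the junk `φ_m(0) = 1`.
[cite: NasserdenXiao2024, (2.5) p. 9 and §6.2 p. 25] -/
def stackyHeight (m : ℕ) (δ : ℝ) (x y : ℤ) : ℝ :=
  ((stackyPhi m x.natAbs * stackyPhi m y.natAbs * stackyPhi m (x + y).natAbs : ℕ) : ℝ) ^ (1 / (m : ℝ))
    * ((max x.natAbs y.natAbs : ℕ) : ℝ) ^ δ

/-- **`StackyNorthcottWith m κ`: the function `H_{−K_{𝔛_m}} · H^κ = ℋ^{3/m − 1 + κ}` has Northcott's property
on `ℙ¹(ℚ)`** — for every real `B` only finitely many coprime integer pairs `(x, y)` have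
`stackyHeight m (3/m − 1 + κ) x y ≤ B` (Nasserden–Xiao Thm 1.4 item (2) / Thm 2.8 with `δ = δ(𝐦) + κ`, for
the single curve `𝔛_m`). STATUS by range: `3/m − 1 + κ > 0` (all `m ≤ 3` with `κ > 0`, or `κ > 1 − 3/m`):
TRUE unconditionally (`stackyNorthcottWith_of_exponent_pos`, NX Thm 2.7); `κ ≤ 0`, `m ≥ 3`: FALSE (NX Thm 1.3
«Northfail», not formalised here); `m ≥ 4`, `0 < κ ≤ 1 − 3/m`: OPEN, implied by abc (`stackyNorthcottWith_of_abc`)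
and implying «NOT abc — POLY-ABC((m−1)/(m−3−κm))» when `κm < m − 3` (`polyABC_of_stackyNorthcottWith`). For
`m = 4` this is, with `δ = 4κ`, ESZB's displayed instance of their Conjecture 35 (FMS 2023 p. 32: «the
inequality `Φ₄(a)Φ₄(b)Φ₄(a+b) < max(|a|,|b|)^{1−δ}` holds for only finitely many pairs of coprime integers»).
A predicate; nothing is asserted.
CALIBRATION (R2; abc-harv lit-1 CALIB 2026-08-27T18:28Z, file `pub/abc-harv/lanes/lit-1/calib/stacky_quality.json`
sha16 fd4a154759a11fc3; 210 held high-quality abc triples; computed ≠ proved): with the STACKY QUALITY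
`s_m(a,b,c) := (m−3)·log c / log(φ_m(a)φ_m(b)φ_m(c))`, `∀ κ > 0, StackyNorthcottWith m κ` reads «`limsup s_m ≤ 1`
over coprime pairs»; floors of the SHARP (`κ = 0`, constant `1`) form, which is violated for every `m` tested —
consistent with NX's own Northfail, so nothing new is refuted: `max s₄ = 1.2257` at `2·13² + 5⁸ = 3·19⁴`
(then `1.1428` at `2·5⁴·7³ + 37⁴ = 3¹¹·13`, `1.1001` at `11·43³ + 3⁸·7³ = 2³·5⁸`; 3/210 above 1), `max s₅ = 1.4558`
at Reyssat's `2 + 3¹⁰·109 = 23⁵` (35/210 above 1), `s₆ = 1.6216` at `2⁷·5² + 7⁶·41 = 13⁶`, `s₁₂ = 1.7222` at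
`7³ + 3¹⁰ = 2¹¹·29`; any EXPLICIT variant «`s_m ≤ 1 + κ` off a stated finite set» must clear these. No finite
table touches the limsup (REDUCTION-CENSUS §F F1: CALIBRATE-ONLY). Floors only; a calibration bounds constants
from BELOW and is no evidence for the statement.
[cite: NasserdenXiao2024, Thm 1.4 (2) p. 4; (2.5) and Thm 2.8 p. 9] [status: open for m ≥ 4, 0 < κ ≤ 1 − 3/m] -/
@[conjecture] def StackyNorthcottWith (m : ℕ) (κ : ℝ) : Prop :=
  ∀ B : ℝ, {p : ℤ × ℤ | IsCoprime p.1 p.2 ∧ stackyHeight m (3 / (m : ℝ) - 1 + κ) p.1 p.2 ≤ B}.Finite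

/-- **`StackyNorthcott m` — item (2) of Nasserden–Xiao's Theorem 1.4 for the ONE stacky curve
`𝔛_m = 𝔛(ℙ¹ : ((0,1,∞) : (m,m,m)))`** (stacky points moved to `0, ∞, −1`): «for all `δ > 0` the function
`ℋ_{−K_{𝔛_m}} · H^δ` has Northcott's property». Door C13 of the abc-harv REDUCTION CENSUS (POLY-ABC band):
for `m ≥ 4` it is OPEN and SANDWICHED — abc ⟹ `StackyNorthcott m` (NX Thm 2.8; kernel:
`Summit.ABC.Harvest.stackyNorthcott_of_abc`, every `m ≥ 1`) and `StackyNorthcott m` ⟹ `PolyABC M` for every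
`M > c_m = (m−1)/(m−3)` (NX §1 p. 4 «some `c_m ≥ 1`», §6.2; kernel: `polyABC_of_stackyNorthcott`) — «NOT abc —
POLY-ABC(c_m + ε)»: `m = 4 ↦ 3+ε`, `5 ↦ 2+ε`, `6 ↦ 5/3+ε`, `m → ∞ ↦ 1+ε`; not known equivalent to either end
for fixed `m`; the full ladder `∀ m ≥ 4` is EQUIVALENT to abc (NX Thm 1.4; kernel:
`abc_iff_forall_stackyNorthcott`) — a restatement, not a path. For `m ≤ 3` it is trivially true (NX Thm 2.7;
`stackyNorthcottWith_of_exponent_pos`). PATH-TO-ABC: none in print beyond the ladder; ESZB p. 32 «might not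
be as far out of reach as abc» is the authors' hope. EFFECTIVE: no (finiteness hypothesis). CHEAPEST FALSIFIER:
an infinite family of coprime `(x, y)` with `φ₄(x)φ₄(y)φ₄(x+y) ≤ max(|x|,|y|)^{1−κ}` would refute
`StackyNorthcott 4` AND abc — none known. CALIBRATION: see `StackyNorthcottWith` (`s₄ 1.2257`, `s₅ 1.4558`).
abc is not proved by any of this; POLY-ABC(M) is NOT abc; A-PS is NOT abc; typed ≠ proved.
[cite: NasserdenXiao2024, Thm 1.4 (2) and the remark after it, p. 4] [status: open for m ≥ 4] -/
@[conjecture] def StackyNorthcott (m : ℕ) : Prop :=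
  ∀ κ : ℝ, 0 < κ → StackyNorthcottWith m κ

/-! ## §2 Toolkit for `φ_m` (elementary; used by both arrows in `GlueStacky.lean`) -/

namespace StackyPhi

/-- The defining set of `φ_m(n)` is nonempty for `m ≥ 1` (witness `n^{m−1}`, or `1` for `n = 0`). [folklore] -/
theorem set_nonempty {m : ℕ} (hm : 0 < m) (n : ℕ) :
    ({d : ℕ | 0 < d ∧ ∃ k : ℕ, n * d = k ^ m} : Set ℕ).Nonempty := by
  rcases Nat.eq_zero_or_pos n with rfl | hn
  · exact ⟨1, Nat.one_pos, 0, by rw [zero_mul, zero_pow hm.ne']⟩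
  · refine ⟨n ^ (m - 1), Nat.pow_pos hn, n, ?_⟩
    rw [← pow_succ', Nat.sub_add_cancel hm]

/-- `φ_m(n) ≥ 1` and `n · φ_m(n)` is an `m`-th power (`m ≥ 1`): the printed definition.
[cite: NasserdenXiao2024, §2.1 p. 6] -/
theorem spec {m : ℕ} (hm : 0 < m) (n : ℕ) :
    0 < stackyPhi m n ∧ ∃ k : ℕ, n * stackyPhi m n = k ^ m :=
  Nat.sInf_mem (set_nonempty hm n)

/-- `φ_m(n) ≥ 1` for `m ≥ 1`. [folklore] -/
theorem pos {m : ℕ} (hm : 0 < m) (n : ℕ) : 0 < stackyPhi m n := (spec hm n).1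

/-- Minimality: any positive `d` with `n · d` an `m`-th power bounds `φ_m(n)`. [folklore] -/
theorem le_of_mul_eq_pow {m n d k : ℕ} (hd : 0 < d) (hk : n * d = k ^ m) : stackyPhi m n ≤ d :=
  Nat.sInf_le ⟨hd, k, hk⟩

/-- **`rad(n)^m ≤ n · φ_m(n)`** (`n, m ≥ 1`): `n · φ_m(n) = k^m` is divisible by every prime of `n`, hence
`rad(n) ∣ rad(k^m) = rad(k) ∣ k` and `rad(n)^m ∣ k^m`. The input of abc ⟹ Northcott. [folklore] -/
theorem radical_pow_le_mul {m n : ℕ} (hm : 0 < m) (hn : 0 < n) :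
    radical n ^ m ≤ n * stackyPhi m n := by
  obtain ⟨hφ, k, hk⟩ := spec hm n
  have hk0 : k ≠ 0 := by
    rintro rfl
    rw [zero_pow hm.ne'] at hk
    exact (Nat.mul_pos hn hφ).ne' hk
  have h1 : radical n ∣ k := by
    have hdvd : n ∣ k ^ m := ⟨stackyPhi m n, hk.symm⟩
    have h := radical_dvd_radical hdvd (pow_ne_zero m hk0)
    rw [radical_pow k hm.ne'] at h
    exact h.trans radical_dvd_self
  rw [hk]
  exact Nat.le_of_dvd (Nat.pow_pos (Nat.pos_of_ne_zero hk0)) (pow_dvd_pow_of_dvd h1 m)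

/-- Sub-multiplicativity `φ_m(ab) ≤ φ_m(a) φ_m(b)` (`m ≥ 1`). [folklore] -/
theorem mul_le {m : ℕ} (hm : 0 < m) (a b : ℕ) :
    stackyPhi m (a * b) ≤ stackyPhi m a * stackyPhi m b := by
  obtain ⟨ha, k₁, hk₁⟩ := spec hm a
  obtain ⟨hb, k₂, hk₂⟩ := spec hm b
  refine le_of_mul_eq_pow (Nat.mul_pos ha hb) (k := k₁ * k₂) ?_
  rw [mul_pow, ← hk₁, ← hk₂]; ring

/-- `φ_m(p^e) ≤ p^{m−1}` (`p` prime, `m ≥ 1`): with `e = mq + r`, `0 ≤ r < m`, the witness is `1` (`r = 0`)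
or `p^{m−r}`. [folklore] -/
theorem primePow_le {m p : ℕ} (hm : 0 < m) (hp : p.Prime) (e : ℕ) :
    stackyPhi m (p ^ e) ≤ p ^ (m - 1) := by
  obtain ⟨q, r, hr, rfl⟩ : ∃ q r, r < m ∧ e = m * q + r :=
    ⟨e / m, e % m, Nat.mod_lt e hm, (Nat.div_add_mod e m).symm⟩
  rcases Nat.eq_zero_or_pos r with rfl | hr0
  · calc stackyPhi m (p ^ (m * q + 0)) ≤ 1 :=
          le_of_mul_eq_pow Nat.one_pos (k := p ^ q) (by rw [add_zero, mul_one, ← pow_mul, mul_comm, pow_mul])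
      _ ≤ p ^ (m - 1) := Nat.one_le_pow _ _ hp.pos
  · calc stackyPhi m (p ^ (m * q + r)) ≤ p ^ (m - r) :=
          le_of_mul_eq_pow (Nat.pow_pos hp.pos) (k := p ^ (q + 1)) (by
            rw [← pow_add, ← pow_mul]
            congr 1
            have h1 : r + (m - r) = m := Nat.add_sub_cancel' hr.le
            calc m * q + r + (m - r) = m * q + (r + (m - r)) := by ring
              _ = (q + 1) * m := by rw [h1]; ring)
      _ ≤ p ^ (m - 1) := Nat.pow_le_pow_right hp.pos (by omega)

/-- **«Trivially `φ_m(u) ≤ rad(u)^{m−1}`»** (Nasserden–Xiao §6.2, p. 25), for `u ≥ 1`, `m ≥ 1`: induction over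
the prime-power factorisation with `primePow_le`, sub-multiplicativity and `rad(p^e · a) = p · rad(a)` for
`p ∤ a`. The input of Northcott ⟹ poly-abc. [cite: NasserdenXiao2024, §6.2 p. 25] -/
theorem le_radical_pow {m : ℕ} (hm : 0 < m) {n : ℕ} (hn : n ≠ 0) :
    stackyPhi m n ≤ radical n ^ (m - 1) := by
  induction n using Nat.recOnPrimePow with
  | zero => exact absurd rfl hn
  | one => simpa using le_of_mul_eq_pow (m := m) (n := 1) Nat.one_pos (k := 1) (by simp)
  | prime_pow_mul a p e hp hpa he ih =>
    have ha0 : a ≠ 0 := by rintro rfl; simp at hn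
    have hcop : IsRelPrime (p ^ e) a := by
      rw [← Nat.coprime_iff_isRelPrime]
      exact Nat.Coprime.pow_left e ((Nat.Prime.coprime_iff_not_dvd hp).mpr hpa)
    calc stackyPhi m (p ^ e * a) ≤ stackyPhi m (p ^ e) * stackyPhi m a := mul_le hm _ _
      _ ≤ p ^ (m - 1) * radical a ^ (m - 1) := Nat.mul_le_mul (primePow_le hm hp e) (ih ha0)
      _ = radical (p ^ e * a) ^ (m - 1) := by
          rw [radical_mul hcop, radical_pow_of_prime hp.prime he.ne', mul_pow, normalize_eq]

end StackyPhi

/-! ## §3 Two facts about the height used by the glue -/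

/-- `ℋ^δ_m(x, y) > 0` at every point of `ℙ¹(ℚ)` (`m ≥ 1`; a coprime pair is not `(0,0)`). [folklore] -/
theorem stackyHeight_pos {m : ℕ} (hm : 0 < m) (δ : ℝ) {x y : ℤ} (hxy : IsCoprime x y) :
    0 < stackyHeight m δ x y := by
  unfold stackyHeight
  apply mul_pos
  · apply Real.rpow_pos_of_pos
    exact_mod_cast Nat.mul_pos (Nat.mul_pos (StackyPhi.pos hm _) (StackyPhi.pos hm _))
      (StackyPhi.pos hm _)
  · apply Real.rpow_pos_of_pos
    have hne : ¬ (x = 0 ∧ y = 0) := by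
      rintro ⟨rfl, rfl⟩; exact not_isCoprime_zero_zero hxy
    have : 0 < max x.natAbs y.natAbs := by
      rcases not_and_or.mp hne with hx | hy
      · exact lt_max_of_lt_left (Int.natAbs_pos.mpr hx)
      · exact lt_max_of_lt_right (Int.natAbs_pos.mpr hy)
    exact_mod_cast this

/-- The height of `𝔛_m` at the point `[a : b]` with natural `a, b` (the positive cone, where abc triples
`a + b = c` live): `(φ_m(a) φ_m(b) φ_m(a+b))^{1/m} · max(a,b)^δ`. [folklore] -/
theorem stackyHeight_natCast (m : ℕ) (δ : ℝ) (a b : ℕ) :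
    stackyHeight m δ a b =
      ((stackyPhi m a * stackyPhi m b * stackyPhi m (a + b) : ℕ) : ℝ) ^ (1 / (m : ℝ))
        * ((max a b : ℕ) : ℝ) ^ δ := by
  unfold stackyHeight
  rw [← Nat.cast_add, Int.natAbs_natCast, Int.natAbs_natCast, Int.natAbs_natCast]

end Summit.ABC.Harvest
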